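import Literature.Analysis.FluidPDE.LerayHopfTimeSliceTorus
import Literature.Analysis.FluidPDE.LerayHopfSpectralMeasurability
import Literature.Analysis.FluidPDE.NSUniqueness2DTruncatedBalance
import Literature.Analysis.FunctionSpaces.DuBoisReymondAE
import HarnessLib

/-!
# The truncated cross identity for two Leray–Hopf solutions on the flat torus

Analysis/FluidPDE file (theorem-only): the Galerkin-level form of **Serrin's cross-testing** of
two weak solutions of the Navier–Stokes equations against each other (Serrin 1963, §4, proof of
Thm. 6; Robinson–Rodrigo–Sadowski 2016, Lemma 8.18; Bardos–Lopes Filho–Niu–Nussenzveig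
Lopes–Titi 2013, proof of Thm. 3.1: "using `u^ε` as test function in the weak formulation of
the equation for `v`, and `v^ε` as test function for the equation for `u`, we find the following
two identities …"), on the flat torus `T^d = UnitAddTorus d` and in the vocabulary of the
accepted `Torus.IsLerayHopfOn` (`FluidPDE/LerayHopf`). Instead of mollifying in time (where a
limit `ε → 0` must be justified), we test with the **Fourier truncations** `P_M u(s)`, `P_M U(s)`
(`Torus.fourierTruncate`), which are admissible smooth divergence-free test fields, and obtain
an exact identity at every level `M`
(`Torus.IsLerayHopfOn.integral_inner_fourierTruncate_eq_add_setIntegral`):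

  `⟪P_M u(t), P_M U(t)⟫_{L²} = ⟪P_M u₀, P_M U₀⟫_{L²} + ∫_{(0,t]} (Φ[u; P_M U(s)](s) + Φ[U; P_M u(s)](s)) ds`,

`t ∈ (0, T]`, where `Φ[v; Ψ](s) = ∫ (⟪v(s),(v(s)·∇)Ψ⟫ + ν⟪v(s),ΔΨ⟫ + ⟪F(s),Ψ⟫)` is the flux of
the time-sliced weak formulation `⟪u(t),Ψ⟫ = ⟪u₀,Ψ⟫ + ∫₀ᵗ Φ[u;Ψ]`
(`Torus.IsLerayHopfOn.integral_inner_eq_add_setIntegral`, `LerayHopfTimeSliceTorus`; against a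
frame field it is `modeFlux` of `NSEnstrophyBalanceRegular2D`). General `d`, two viscosities,
two space–time square-integrable forces, `L²` data. The limit `M → ∞` (where Prodi–Serrin-type
or anisotropic hypotheses enter) is left to the consumers: the two-and-a-half-dimensional
weak–strong uniqueness theorem of Bardos et al. 2013 on `T³` (`FluidPDE/NSUniqueness2HalfD`,
discharging `BardosTitiWiedemann2012_thm5_uniqueness`) and the two-dimensional Lions–Prodi
programme (`NSUniqueness2DParts`).

## Proof, as formalised

* **The Galerkin frame** is the accepted one of `StatisticalSolutionEnergyEq`
  (`Torus.perpVec`, `Torus.frameVec`, `Torus.frameField k j c`: the real single modes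
  `cos(2πk·x) perpVec k j`, `sin(2πk·x) perpVec k j`), used here at **every** frequency, the mean
  mode `k = 0` included (`Torus.sum_mul_frameVec'`, `Torus.isDivFree_frameField'`: the `k ≠ 0`
  hypotheses of the accepted lemmas are vacuous at `k = 0`). The frame is self-dual on
  transversal vectors (`Torus.sum_sum_re_inner_frameVec_smul`), so for a weakly divergence-free
  `L²` field `P_M w = ∑_{|k|≤M,j,c} ⟪w, g_{kjc}⟫ g_{kjc}` over the **full** ball
  (`Torus.sum_frame_smul_eq_fourierTruncate'` — the accepted `Torus.sum_frame_smul_eq_fourierTruncate`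
  runs over `0 < |k| ≤ M` under a mean-zero hypothesis, which two solutions with non-zero mean do
  not satisfy) and `⟪P_M u, P_M b⟫ = ∑ᵢ ⟪u,gᵢ⟫⟪b,gᵢ⟫`
  (`Torus.integral_inner_fourierTruncate_fourierTruncate_eq_sum`).
* Every slice `u(t)`, `t ∈ (0,T]`, of a Leray–Hopf solution is weakly divergence free
  (accepted `Torus.IsLerayHopfOn.isWeaklyDivFree_of_mem_Ioc`).
* Each frame coefficient has the time-sliced representation; the **product formula for
  primitives** (`FunctionSpaces.mul_eq_add_setIntegral_of_eq_add_setIntegral`, `DuBoisReymondAE`)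
  and the linearity of `Ψ ↦ Φ[v; Ψ]` over finite real combinations (`Torus.sum_mul_flux_eq`)
  give the identity; the integrand is integrable on `(0,t]`, and each cross flux
  `s ↦ Φ[u; P_M U(s)](s)` is integrable on `(0,T)` (`Torus.IsLerayHopfOn.integrableOn_flux_fourierTruncate`).

## Mathlib search / tree search

Mathlib (this pin) has no Navier–Stokes weak formulations (searched `Leray`, `Galerkin`,
`trigPoly`: tree only); used: Bochner integration, `Integrable.bdd_mul`. Tree: the frame
`Torus.perpVec` / `Torus.frameVec` / `Torus.frameField` with `sum_mul_perpVec(_of_transversal)`,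
`sum_smul_complexify_perpVec`, `sum_sum_re_inner_frameVec_smul`, `isDivFree_frameField`,
`sum_frame_smul_eq_fourierTruncate` (`StatisticalSolutionEnergyEq`, `NSUniqueness2DTruncatedBalance`),
the mode functionals `modePairing` / `modeFlux` (`NSEnstrophyBalanceRegular2D`, one solution
against one frame field), `Torus.exists_transversal_frame` / `Torus.fourierTruncate_eq_sum_frame`
(`NSHopfGalerkinLimit`). What is new: the identity pairs **two** Leray–Hopf solutions with each
other (`NSGalerkinCrossIdentity` pairs a solution with a `C¹` Galerkin curve;
`NSUniqueness2DTruncatedBalance.truncated_difference_balance` tests both equations of one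
system with `P_N(u - v)`, which in three dimensions would drag in the Galerkin energy defect of
each solution — the cross identity avoids it), plus the full-ball frame expansion.

## References

* J. Serrin, *The initial value problem for the Navier–Stokes equations*, in: Nonlinear
  Problems (Madison 1962), Univ. Wisconsin Press 1963, §4, Thm. 6. [Serrin1963]
* C. Bardos, M. C. Lopes Filho, D. Niu, H. J. Nussenzveig Lopes, E. S. Titi, SIAM J. Math.
  Anal. 45 (2013) 1871–1885, Thm. 3.1 (proof). [BardosEtAl2013]
* J. C. Robinson, J. L. Rodrigo, W. Sadowski, *The three-dimensional Navier–Stokes equations*,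
  CUP 2016, Def. 2.1, Lemma 2.9, §4.1, Lemma 8.18. [RobinsonRodrigoSadowski2016]
* R. Temam, *Navier–Stokes Equations*, 3rd ed., North-Holland 1984, Ch. III §1.1 (1.25). [Temam1984]
-/

noncomputable section

open MeasureTheory TopologicalSpace Set Function Filter Topology UnitAddTorus
open scoped InnerProductSpace RealInnerProductSpace ENNReal NNReal

namespace Literature.Analysis.FluidPDE

namespace Torus

variable {d : Type*} [Fintype d] [DecidableEq d]

/-! ## The Galerkin frame of `StatisticalSolutionEnergyEq`, at every frequency (the mean mode included) -/

/-- The frame amplitudes are transversal at **every** frequency (at `k = 0` the sum is a sum of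
zeros; for `k ≠ 0` this is `Torus.sum_mul_frameVec`). [folklore] -/
theorem sum_mul_frameVec' (k : d → ℤ) (j : d) (c : Bool) : ∑ i, (k i : ℂ) * frameVec k j c i = 0 := by
  rcases eq_or_ne k 0 with rfl | hk
  · simp
  · exact sum_mul_frameVec hk j c

/-- Frame fields are divergence free at **every** frequency (`Torus.isDivFree_frameField` assumes
`k ≠ 0`; the mean modes `frameField 0 j c` are constant fields). [folklore] -/
theorem isDivFree_frameField' (k : d → ℤ) (j : d) (c : Bool) : FunctionSpaces.Torus.IsDivFree (frameField k j c) :=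
  FunctionSpaces.Torus.isDivFree_realTrigPoly_singleton (sum_mul_frameVec' k j c)

/-- Frame fields are continuous. [folklore] -/
theorem continuous_frameField (k : d → ℤ) (j : d) (c : Bool) : Continuous (frameField k j c) :=
  (isSmooth_frameField k j c).continuous

/-- Frame fields are in every `L^p`. [folklore] -/
theorem memLp_frameField (k : d → ℤ) (j : d) (c : Bool) (p : ℝ≥0∞) : MemLp (frameField k j c) p volume :=
  FunctionSpaces.Torus.memLp_realTrigPoly _ _ p

/-- Frame fields with frequency in the ball of radius `M` are band-limited to that ball. [folklore] -/
theorem mFourierCoeff_frameField_eq_zero_of_not_mem {M : ℕ} {k : d → ℤ} (hk : k ∈ FunctionSpaces.Torus.freqBall M)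
    (j : d) (c : Bool) {k' : d → ℤ} (hk' : k' ∉ FunctionSpaces.Torus.freqBall M) :
    mFourierCoeff (FunctionSpaces.EuclideanSpace.complexify ∘ frameField k j c) k' = 0 :=
  FunctionSpaces.Torus.mFourierCoeff_realTrigPoly_singleton_eq_zero k _
    ((FunctionSpaces.Torus.mem_freqBall.1 hk).trans_lt (FunctionSpaces.Torus.not_mem_freqBall.1 hk'))

/-- The truncation is invisible when pairing with a frame field inside the ball:
`⟪P_M u, g_{kjc}⟫_{L²} = ⟪u, g_{kjc}⟫_{L²}` for `|k| ≤ M`. [folklore] -/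
theorem integral_inner_fourierTruncate_frameField {u : UnitAddTorus d → EuclideanSpace ℝ d} (hu : MemLp u 2 volume)
    {M : ℕ} {k : d → ℤ} (hk : k ∈ FunctionSpaces.Torus.freqBall M) (j : d) (c : Bool) :
    ∫ x, ⟪FunctionSpaces.Torus.fourierTruncate M u x, frameField k j c x⟫ = ∫ x, ⟪u x, frameField k j c x⟫ :=
  FunctionSpaces.Torus.integral_inner_fourierTruncate_eq hu (memLp_frameField k j c 2)
    fun _ hk' => mFourierCoeff_frameField_eq_zero_of_not_mem hk j c hk'

/-- **The frame reproduces the truncation over the full ball** (the mean mode included): for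
`w ∈ L²(T^d; ℝ^d)` weakly divergence free,
`∑_{|k|≤N} ∑ⱼ ∑_c ⟪w, g_{kjc}⟫ g_{kjc}(x) = P_N w (x)` — the accepted
`Torus.sum_frame_smul_eq_fourierTruncate` over `freqBall₀` without its mean-zero hypothesis
(its one-frequency step uses only the transversality of `ŵ(k)`, valid at `k = 0` too). [folklore] -/
theorem sum_frame_smul_eq_fourierTruncate' {w : UnitAddTorus d → EuclideanSpace ℝ d} (hw : MemLp w 2 volume)
    (hdiv : FunctionSpaces.Torus.IsWeaklyDivFree w) (N : ℕ) (x : UnitAddTorus d) :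
    ∑ k ∈ FunctionSpaces.Torus.freqBall N, ∑ j, ∑ c, (∫ y, ⟪w y, frameField k j c y⟫) • frameField k j c x =
      FunctionSpaces.Torus.fourierTruncate N w x := by
  have hint : Integrable w volume := hw.integrable one_le_two
  have key : ∀ k ∈ FunctionSpaces.Torus.freqBall N, ∑ j, ∑ c, (∫ y, ⟪w y, frameField k j c y⟫) • frameField k j c x =
      FunctionSpaces.EuclideanSpace.realPart (mFourier k x • mFourierCoeff (FunctionSpaces.EuclideanSpace.complexify ∘ w) k) := by
    intro k _
    simp_rw [frameField, FunctionSpaces.Torus.integral_inner_realTrigPoly_singleton hint,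
      FunctionSpaces.Torus.realTrigPoly_singleton_apply, smul_realPart_mFourier_smul, ← map_sum, ← Finset.smul_sum]
    rw [sum_sum_re_inner_frameVec_smul (hdiv.sum_mul_mFourierCoeff_eq_zero hw k)]
  rw [Finset.sum_congr rfl key, FunctionSpaces.Torus.fourierTruncate_eq, FunctionSpaces.Torus.realTrigPoly_apply_eq_sum]

/-- The full-ball frame expansion, indexed by the product finset
`freqBall N ×ˢ univ ×ˢ univ` of triples `(k, j, c)` (function form). [folklore] -/
theorem fourierTruncate_eq_sum_integral_inner_smul_frameField {w : UnitAddTorus d → EuclideanSpace ℝ d}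
    (hw : MemLp w 2 volume) (hdiv : FunctionSpaces.Torus.IsWeaklyDivFree w) (N : ℕ) :
    FunctionSpaces.Torus.fourierTruncate N w = fun x =>
      ∑ i ∈ FunctionSpaces.Torus.freqBall N ×ˢ ((Finset.univ : Finset d) ×ˢ (Finset.univ : Finset Bool)),
        (∫ y, ⟪w y, frameField i.1 i.2.1 i.2.2 y⟫) • frameField i.1 i.2.1 i.2.2 x := by
  funext x
  rw [← sum_frame_smul_eq_fourierTruncate' hw hdiv N x, Finset.sum_product]
  refine Finset.sum_congr rfl fun k _ => ?_
  rw [Finset.sum_product]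

/-- **Truncated inner products along the frame**: for `L²` fields `u, b` with `b` weakly
divergence free, `⟪P_M u, P_M b⟫_{L²} = ∑_{(k,j,c)} ⟪u, g_{kjc}⟫_{L²} ⟪b, g_{kjc}⟫_{L²}` over
`|k| ≤ M`. [folklore] -/
theorem integral_inner_fourierTruncate_fourierTruncate_eq_sum {u b : UnitAddTorus d → EuclideanSpace ℝ d}
    (hu : MemLp u 2 volume) (hb : MemLp b 2 volume) (hdiv : FunctionSpaces.Torus.IsWeaklyDivFree b) (M : ℕ) :
    ∫ x, ⟪FunctionSpaces.Torus.fourierTruncate M u x, FunctionSpaces.Torus.fourierTruncate M b x⟫ =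
      ∑ i ∈ FunctionSpaces.Torus.freqBall M ×ˢ ((Finset.univ : Finset d) ×ˢ (Finset.univ : Finset Bool)),
        (∫ y, ⟪u y, frameField i.1 i.2.1 i.2.2 y⟫) * ∫ y, ⟪b y, frameField i.1 i.2.1 i.2.2 y⟫ := by
  rw [fourierTruncate_eq_sum_integral_inner_smul_frameField hb hdiv M]
  simp_rw [inner_sum, real_inner_smul_right]
  have hint : ∀ i ∈ FunctionSpaces.Torus.freqBall M ×ˢ ((Finset.univ : Finset d) ×ˢ (Finset.univ : Finset Bool)),
      Integrable (fun x => (∫ y, ⟪b y, frameField i.1 i.2.1 i.2.2 y⟫) *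
        ⟪FunctionSpaces.Torus.fourierTruncate M u x, frameField i.1 i.2.1 i.2.2 x⟫) volume := fun i _ =>
    (FunctionSpaces.Torus.integrable_inner_of_continuous
      ((FunctionSpaces.Torus.memLp_fourierTruncate M u 2).integrable one_le_two)
      (continuous_frameField _ _ _)).const_mul _
  rw [integral_finsetSum _ hint]
  refine Finset.sum_congr rfl fun i hi => ?_
  rw [integral_const_mul, integral_inner_fourierTruncate_frameField hu (Finset.mem_product.1 hi).1, mul_comm]

/-! ## Linearity of the tested pairing over finite real combinations of smooth test fields -/

/-- **Linearity of the tested Navier–Stokes pairing in the test field**: for `v ∈ L²`, `F ∈ L¹`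
and smooth `aᵢ`,
`∑ᵢ cᵢ ∫(⟪v,(v·∇)aᵢ⟫ + ν⟪v,Δaᵢ⟫ + ⟪F,aᵢ⟫) = ∫(⟪v,(v·∇)Ψ⟫ + ν⟪v,ΔΨ⟫ + ⟪F,Ψ⟫)`, `Ψ = ∑ᵢ cᵢ aᵢ`
(each summand is integrable, `integrable_nsFluxIntegrand`; `(v·∇)` and `Δ` are linear). The
integral is the flux of the time-sliced weak formulation (`modeFlux` of
`NSEnstrophyBalanceRegular2D` when `Ψ` is a frame field). [folklore] -/
theorem sum_mul_flux_eq {ι : Type*} (I : Finset ι) (c : ι → ℝ)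
    {a : ι → UnitAddTorus d → EuclideanSpace ℝ d} (ha : ∀ i, FunctionSpaces.Torus.IsSmooth (a i)) (ν : ℝ)
    {F v : UnitAddTorus d → EuclideanSpace ℝ d} (hv : MemLp v 2 volume) (hF : Integrable F volume) :
    ∑ i ∈ I, c i * ∫ x, (⟪v x, FunctionSpaces.Torus.convect v (a i) x⟫ + ν * ⟪v x, FunctionSpaces.Torus.laplacian (a i) x⟫ +
        ⟪F x, a i x⟫) =
      ∫ x, (⟪v x, FunctionSpaces.Torus.convect v (fun y => ∑ i ∈ I, c i • a i y) x⟫ +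
        ν * ⟪v x, FunctionSpaces.Torus.laplacian (fun y => ∑ i ∈ I, c i • a i y) x⟫ + ⟪F x, ∑ i ∈ I, c i • a i x⟫) := by
  have iB : ∀ i, Integrable (fun x => ⟪v x, FunctionSpaces.Torus.convect v (a i) x⟫ +
      ν * ⟪v x, FunctionSpaces.Torus.laplacian (a i) x⟫ + ⟪F x, a i x⟫) volume := fun i =>
    integrable_nsFluxIntegrand hv hF (ha i) ν
  simp_rw [← integral_const_mul]
  rw [← integral_finsetSum I fun i _ => (iB i).const_mul _]
  refine integral_congr_ae (ae_of_all _ fun x => ?_)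
  dsimp only
  rw [Torus.convect_finset_sum_smul I c ha, Torus.laplacian_finset_sum_smul I c ha]
  simp only [inner_sum, inner_smul_right, Finset.mul_sum, ← Finset.sum_add_distrib]
  refine Finset.sum_congr rfl fun i _ => ?_
  ring

/-! ## The truncated cross identity -/

section Cross

variable {T ν₁ ν₂ : ℝ} {f g u U : ℝ → UnitAddTorus d → EuclideanSpace ℝ d}
  {u₀ U₀ : UnitAddTorus d → EuclideanSpace ℝ d}

/-- **The cross pairing is integrable in time**: for Leray–Hopf solutions `u` (force `f`) and
`U` on `[0, T)`, `s ↦ ∫(⟪u,(u·∇)P_M U⟫ + ν⟪u,ΔP_M U⟫ + ⟪f,P_M U⟫)(s)` is integrable on `(0, T)`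
(along the frame it is `∑ᵢ ⟪U(s), gᵢ⟫ · (flux of u against gᵢ)`, bounded coefficients times
integrable fluxes). [folklore] -/
theorem IsLerayHopfOn.integrableOn_flux_fourierTruncate
    (hu : IsLerayHopfOn T ν₁ f u₀ u) (hU : IsLerayHopfOn T ν₂ g U₀ U)
    (hfm : AEStronglyMeasurable (FunctionSpaces.Torus.stLift f) (volume.restrict (Ioo 0 T ×ˢ univ)))
    (hf₂ : ∫⁻ t in Ioo 0 T, ∫⁻ x, ‖f t x‖ₑ ^ 2 < ⊤) (M : ℕ) :
    IntegrableOn (fun s => ∫ x, (⟪u s x, FunctionSpaces.Torus.convect (u s) (FunctionSpaces.Torus.fourierTruncate M (U s)) x⟫ +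
        ν₁ * ⟪u s x, FunctionSpaces.Torus.laplacian (FunctionSpaces.Torus.fourierTruncate M (U s)) x⟫ +
        ⟪f s x, FunctionSpaces.Torus.fourierTruncate M (U s) x⟫)) (Ioo 0 T) := by
  classical
  set I : Finset ((d → ℤ) × d × Bool) := FunctionSpaces.Torus.freqBall M ×ˢ ((Finset.univ : Finset d) ×ˢ (Finset.univ : Finset Bool))
    with hI
  set a : (d → ℤ) × d × Bool → UnitAddTorus d → EuclideanSpace ℝ d := fun i => frameField i.1 i.2.1 i.2.2 with ha
  have ha_smooth : ∀ i, FunctionSpaces.Torus.IsSmooth (a i) := fun i => isSmooth_frameField _ _ _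
  have ha_cont : ∀ i, Continuous (a i) := fun i => continuous_frameField _ _ _
  -- the frame expansion, for a.e. `s`
  have hIdent : ∀ᵐ s ∂(volume.restrict (Ioo 0 T)),
      ∑ i ∈ I, (∫ x, ⟪U s x, a i x⟫) * ∫ x, (⟪u s x, FunctionSpaces.Torus.convect (u s) (a i) x⟫ +
          ν₁ * ⟪u s x, FunctionSpaces.Torus.laplacian (a i) x⟫ + ⟪f s x, a i x⟫) =
        ∫ x, (⟪u s x, FunctionSpaces.Torus.convect (u s) (FunctionSpaces.Torus.fourierTruncate M (U s)) x⟫ +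
          ν₁ * ⟪u s x, FunctionSpaces.Torus.laplacian (FunctionSpaces.Torus.fourierTruncate M (U s)) x⟫ +
          ⟪f s x, FunctionSpaces.Torus.fourierTruncate M (U s) x⟫) := by
    filter_upwards [ae_integrable_force_slice hfm hf₂, ae_restrict_mem measurableSet_Ioo] with s hs hsI
    have hsT : s ∈ Ioc 0 T := Ioo_subset_Ioc_self hsI
    have hus : MemLp (u s) 2 volume := hu.memLp s ⟨hsT.1.le, hsT.2⟩
    have hUs : MemLp (U s) 2 volume := hU.memLp s ⟨hsT.1.le, hsT.2⟩
    rw [sum_mul_flux_eq I (fun i => ∫ x, ⟪U s x, a i x⟫) ha_smooth ν₁ hus hs,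
      fourierTruncate_eq_sum_integral_inner_smul_frameField hUs (hU.isWeaklyDivFree_of_mem_Ioc hsT) M]
  -- integrability of the expansion
  have hsum : IntegrableOn (fun s => ∑ i ∈ I, (∫ x, ⟪U s x, a i x⟫) *
      ∫ x, (⟪u s x, FunctionSpaces.Torus.convect (u s) (a i) x⟫ + ν₁ * ⟪u s x, FunctionSpaces.Torus.laplacian (a i) x⟫ +
        ⟪f s x, a i x⟫)) (Ioo 0 T) := by
    refine integrable_finsetSum I fun i _ => ?_
    obtain ⟨C, hC⟩ := hU.exists_ae_abs_integral_inner_le (ha_cont i)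
    exact (hu.integrableOn_flux hfm hf₂ (ha_smooth i)).bdd_mul
      (hU.aestronglyMeasurable_integral_inner (ha_cont i))
      (hC.mono fun s hs => by rwa [Real.norm_eq_abs])
  exact hsum.congr hIdent

/-- **The truncated cross identity for two Leray–Hopf solutions on `T^d`.** Let `u` and `U`
be Leray–Hopf weak solutions on `T^d × [0, T)`, `T > 0`, with viscosities `ν₁, ν₂`, space–time
square-integrable forces `f, g` and `L²` data `u₀, U₀`. Then for every truncation level `M`
and every `t ∈ (0, T]`,
`⟪P_M u(t), P_M U(t)⟫_{L²} = ⟪P_M u₀, P_M U₀⟫_{L²}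
   + ∫_{(0,t]} (Φ[u; P_M U(s)](s) + Φ[U; P_M u(s)](s)) ds`,
`Φ[v; Ψ](s) = ∫(⟪v(s),(v(s)·∇)Ψ⟫ + ν⟪v(s),ΔΨ⟫ + ⟪F(s),Ψ⟫)` the flux of the time-sliced weak
formulation, the integrand being integrable on `(0,t]`. This is the Galerkin-level form of
Serrin's cross-testing of one weak solution against the other (Serrin 1963, §4, proof of
Thm. 6; Bardos–Lopes Filho–Niu–Nussenzveig Lopes–Titi 2013, proof of Thm. 3.1, the two displayed
identities obtained by "using `u^ε` as test function in the weak formulation of the equation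
for `v`, and `v^ε` as test function for the equation for `u`", here with Fourier truncation in
place of time mollification, so that no limit is taken). Proof: along the Galerkin frame
`g_{kjc}` (`Torus.frameField`), `⟪P_M u(t), P_M U(t)⟫ = ∑ᵢ ⟪u(t), gᵢ⟫⟪U(t), gᵢ⟫`; each factor has
the time-sliced representation `⟪u(t), gᵢ⟫ = ⟪u₀, gᵢ⟫ + ∫_{(0,t]} Φ[u; gᵢ]`
(`Torus.IsLerayHopfOn.integral_inner_eq_add_setIntegral`); the product formula for primitives
(`FunctionSpaces.mul_eq_add_setIntegral_of_eq_add_setIntegral`) and the linearity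
`∑ᵢ ⟪U(s), gᵢ⟫ Φ[u; gᵢ](s) = Φ[u; P_M U(s)](s)` (every slice `U(s)`, `s ∈ (0,T]`, being weakly
divergence free) conclude. [cite: Serrin1963, §4 (proof of Thm. 6)] [cite: BardosEtAl2013, Thm. 3.1 (proof)] -/
theorem IsLerayHopfOn.integral_inner_fourierTruncate_eq_add_setIntegral
    (hu : IsLerayHopfOn T ν₁ f u₀ u) (hU : IsLerayHopfOn T ν₂ g U₀ U) (hT : 0 < T)
    (hfm : AEStronglyMeasurable (FunctionSpaces.Torus.stLift f) (volume.restrict (Ioo 0 T ×ˢ univ)))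
    (hf₂ : ∫⁻ t in Ioo 0 T, ∫⁻ x, ‖f t x‖ₑ ^ 2 < ⊤)
    (hgm : AEStronglyMeasurable (FunctionSpaces.Torus.stLift g) (volume.restrict (Ioo 0 T ×ˢ univ)))
    (hg₂ : ∫⁻ t in Ioo 0 T, ∫⁻ x, ‖g t x‖ₑ ^ 2 < ⊤)
    (hu₀ : MemLp u₀ 2 volume) (hU₀ : MemLp U₀ 2 volume) (M : ℕ) {t : ℝ} (ht : t ∈ Ioc 0 T) :
    IntegrableOn (fun s =>
        (∫ x, (⟪u s x, FunctionSpaces.Torus.convect (u s) (FunctionSpaces.Torus.fourierTruncate M (U s)) x⟫ +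
          ν₁ * ⟪u s x, FunctionSpaces.Torus.laplacian (FunctionSpaces.Torus.fourierTruncate M (U s)) x⟫ +
          ⟪f s x, FunctionSpaces.Torus.fourierTruncate M (U s) x⟫)) +
        ∫ x, (⟪U s x, FunctionSpaces.Torus.convect (U s) (FunctionSpaces.Torus.fourierTruncate M (u s)) x⟫ +
          ν₂ * ⟪U s x, FunctionSpaces.Torus.laplacian (FunctionSpaces.Torus.fourierTruncate M (u s)) x⟫ +
          ⟪g s x, FunctionSpaces.Torus.fourierTruncate M (u s) x⟫)) (Ioc 0 t) ∧
      ∫ x, ⟪FunctionSpaces.Torus.fourierTruncate M (u t) x, FunctionSpaces.Torus.fourierTruncate M (U t) x⟫ =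
        (∫ x, ⟪FunctionSpaces.Torus.fourierTruncate M u₀ x, FunctionSpaces.Torus.fourierTruncate M U₀ x⟫) +
          ∫ s in Ioc 0 t,
            ((∫ x, (⟪u s x, FunctionSpaces.Torus.convect (u s) (FunctionSpaces.Torus.fourierTruncate M (U s)) x⟫ +
              ν₁ * ⟪u s x, FunctionSpaces.Torus.laplacian (FunctionSpaces.Torus.fourierTruncate M (U s)) x⟫ +
              ⟪f s x, FunctionSpaces.Torus.fourierTruncate M (U s) x⟫)) +
            ∫ x, (⟪U s x, FunctionSpaces.Torus.convect (U s) (FunctionSpaces.Torus.fourierTruncate M (u s)) x⟫ +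
              ν₂ * ⟪U s x, FunctionSpaces.Torus.laplacian (FunctionSpaces.Torus.fourierTruncate M (u s)) x⟫ +
              ⟪g s x, FunctionSpaces.Torus.fourierTruncate M (u s) x⟫)) := by
  classical
  -- ### the frame
  set I : Finset ((d → ℤ) × d × Bool) := FunctionSpaces.Torus.freqBall M ×ˢ ((Finset.univ : Finset d) ×ˢ (Finset.univ : Finset Bool))
    with hI
  set a : (d → ℤ) × d × Bool → UnitAddTorus d → EuclideanSpace ℝ d := fun i => frameField i.1 i.2.1 i.2.2 with ha
  have ha_smooth : ∀ i, FunctionSpaces.Torus.IsSmooth (a i) := fun i => isSmooth_frameField _ _ _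
  have ha_div : ∀ i, FunctionSpaces.Torus.IsDivFree (a i) := fun i => isDivFree_frameField' _ _ _
  -- ### divergence-free slices and data
  have hdivu : ∀ s ∈ Ioc 0 T, FunctionSpaces.Torus.IsWeaklyDivFree (u s) := fun s hs => hu.isWeaklyDivFree_of_mem_Ioc hs
  have hdivU : ∀ s ∈ Ioc 0 T, FunctionSpaces.Torus.IsWeaklyDivFree (U s) := fun s hs => hU.isWeaklyDivFree_of_mem_Ioc hs
  have hdivU₀ : FunctionSpaces.Torus.IsWeaklyDivFree U₀ := hU.isWeaklyDivFree_datum hT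
  -- ### the coefficient functions, their fluxes and representations
  set A : (d → ℤ) × d × Bool → ℝ → ℝ := fun i s => ∫ x, ⟪u s x, a i x⟫ with hA
  set B : (d → ℤ) × d × Bool → ℝ → ℝ := fun i s => ∫ x, ⟪U s x, a i x⟫ with hB
  set φ : (d → ℤ) × d × Bool → ℝ → ℝ := fun i s =>
    ∫ x, (⟪u s x, FunctionSpaces.Torus.convect (u s) (a i) x⟫ + ν₁ * ⟪u s x, FunctionSpaces.Torus.laplacian (a i) x⟫ + ⟪f s x, a i x⟫)
    with hφ
  set γ : (d → ℤ) × d × Bool → ℝ → ℝ := fun i s =>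
    ∫ x, (⟪U s x, FunctionSpaces.Torus.convect (U s) (a i) x⟫ + ν₂ * ⟪U s x, FunctionSpaces.Torus.laplacian (a i) x⟫ + ⟪g s x, a i x⟫)
    with hγ
  have hφint : ∀ i, IntegrableOn (φ i) (Ioo 0 T) := fun i => hu.integrableOn_flux hfm hf₂ (ha_smooth i)
  have hγint : ∀ i, IntegrableOn (γ i) (Ioo 0 T) := fun i => hU.integrableOn_flux hgm hg₂ (ha_smooth i)
  have hArep : ∀ i, ∀ s ∈ Ioc 0 T, A i s = (∫ x, ⟪u₀ x, a i x⟫) + ∫ r in Ioc 0 s, φ i r :=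
    fun i s hs => hu.integral_inner_eq_add_setIntegral hT hfm hf₂ (ha_smooth i) (ha_div i) hs
  have hBrep : ∀ i, ∀ s ∈ Ioc 0 T, B i s = (∫ x, ⟪U₀ x, a i x⟫) + ∫ r in Ioc 0 s, γ i r :=
    fun i s hs => hU.integral_inner_eq_add_setIntegral hT hgm hg₂ (ha_smooth i) (ha_div i) hs
  -- ### the product formula, mode by mode
  have hprod := fun i => FunctionSpaces.mul_eq_add_setIntegral_of_eq_add_setIntegral (hφint i) (hγint i)
    (hArep i) (hBrep i) ht
  -- ### sum over the frame
  have hLHS : ∫ x, ⟪FunctionSpaces.Torus.fourierTruncate M (u t) x, FunctionSpaces.Torus.fourierTruncate M (U t) x⟫ =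
      ∑ i ∈ I, A i t * B i t :=
    integral_inner_fourierTruncate_fourierTruncate_eq_sum (hu.memLp t ⟨ht.1.le, ht.2⟩)
      (hU.memLp t ⟨ht.1.le, ht.2⟩) (hdivU t ht) M
  have h0 : ∫ x, ⟪FunctionSpaces.Torus.fourierTruncate M u₀ x, FunctionSpaces.Torus.fourierTruncate M U₀ x⟫ =
      ∑ i ∈ I, (∫ x, ⟪u₀ x, a i x⟫) * ∫ x, ⟪U₀ x, a i x⟫ :=
    integral_inner_fourierTruncate_fourierTruncate_eq_sum hu₀ hU₀ hdivU₀ M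
  have hsumInt : IntegrableOn (fun s => ∑ i ∈ I, (φ i s * B i s + A i s * γ i s)) (Ioc 0 t) :=
    integrable_finsetSum I fun i _ => (hprod i).1
  have hsumEq : ∑ i ∈ I, A i t * B i t = ∑ i ∈ I, (∫ x, ⟪u₀ x, a i x⟫) * (∫ x, ⟪U₀ x, a i x⟫) +
      ∫ s in Ioc 0 t, ∑ i ∈ I, (φ i s * B i s + A i s * γ i s) := by
    rw [integral_finsetSum I fun i _ => (hprod i).1, ← Finset.sum_add_distrib]
    exact Finset.sum_congr rfl fun i _ => (hprod i).2
  -- ### identification of the integrand for a.e. `s ∈ (0, t]`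
  have hsub : Ioc 0 t ⊆ Ioc 0 T := Ioc_subset_Ioc_right ht.2
  have hfL1 := ae_integrable_force_slice hfm hf₂
  have hgL1 := ae_integrable_force_slice hgm hg₂
  have hIdent : ∀ᵐ s ∂(volume.restrict (Ioc 0 t)), ∑ i ∈ I, (φ i s * B i s + A i s * γ i s) =
      (∫ x, (⟪u s x, FunctionSpaces.Torus.convect (u s) (FunctionSpaces.Torus.fourierTruncate M (U s)) x⟫ +
        ν₁ * ⟪u s x, FunctionSpaces.Torus.laplacian (FunctionSpaces.Torus.fourierTruncate M (U s)) x⟫ +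
        ⟪f s x, FunctionSpaces.Torus.fourierTruncate M (U s) x⟫)) +
      ∫ x, (⟪U s x, FunctionSpaces.Torus.convect (U s) (FunctionSpaces.Torus.fourierTruncate M (u s)) x⟫ +
        ν₂ * ⟪U s x, FunctionSpaces.Torus.laplacian (FunctionSpaces.Torus.fourierTruncate M (u s)) x⟫ +
        ⟪g s x, FunctionSpaces.Torus.fourierTruncate M (u s) x⟫) := by
    have h1 : ∀ᵐ s ∂(volume.restrict (Ioc 0 T)), Integrable (f s) volume ∧ Integrable (g s) volume := by
      rw [← Measure.restrict_congr_set Ioo_ae_eq_Ioc]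
      exact hfL1.and hgL1
    have h2 : ∀ᵐ s ∂(volume.restrict (Ioc 0 t)), Integrable (f s) volume ∧ Integrable (g s) volume :=
      ae_restrict_of_ae_restrict_of_subset hsub h1
    filter_upwards [h2, ae_restrict_mem measurableSet_Ioc] with s hs hsI
    have hsT : s ∈ Ioc 0 T := hsub hsI
    have hus : MemLp (u s) 2 volume := hu.memLp s ⟨hsT.1.le, hsT.2⟩
    have hUs : MemLp (U s) 2 volume := hU.memLp s ⟨hsT.1.le, hsT.2⟩
    rw [Finset.sum_add_distrib]
    congr 1
    · have hexp := fourierTruncate_eq_sum_integral_inner_smul_frameField hUs (hdivU s hsT) M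
      calc ∑ i ∈ I, φ i s * B i s = ∑ i ∈ I, B i s * φ i s := Finset.sum_congr rfl fun i _ => mul_comm _ _
        _ = _ := sum_mul_flux_eq I (fun i => B i s) ha_smooth ν₁ hus hs.1
        _ = _ := by rw [hexp]
    · have hexp := fourierTruncate_eq_sum_integral_inner_smul_frameField hus (hdivu s hsT) M
      calc ∑ i ∈ I, A i s * γ i s = _ := sum_mul_flux_eq I (fun i => A i s) ha_smooth ν₂ hUs hs.2
        _ = _ := by rw [hexp]
  refine ⟨hsumInt.congr hIdent, ?_⟩
  rw [hLHS, hsumEq, h0, integral_congr_ae hIdent]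

end Cross

end Torus

end Literature.Analysis.FluidPDE

end
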